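import Summits.Parity.GeneralizedHardyLittlewood.Theorems.PrimeLevelFamEdgeMomentsBeyondDiagonalFarLayersWeil
import Summits.Parity.GeneralizedHardyLittlewood.Theorems.PrimeLevelFamEdgeMomentsBeyondDiagonalLayersBandGlue
import HarnessLib

/-!
# Route `PrimeLevelFamEdge`, crux K_A `MomentsBeyondDiagonal` (stmt-Parity-20007), line «petersson_layers» v4:
# the PRINT BAND from a PER-LAYER bound — top of the `stub_farP` assembly

`stub_farP : SubFar rhoP` is reduced to the print band `SubBand rhoP rhoWeil` (famedge-1, `FarLayers.subFar_rhoP_of_band`),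
and a plain norm bound on the band on a short window is `SubBand` (`Layers.subBand_rhoP_rhoWeil_of_norm_le_window`).  This file
is the next (trivial but load-bearing) layer of the assembly, TOP-DOWN: the band is `O(q̂ log⁻³ q̂)` as soon as every layer in it
satisfies a POWER-SAVING per-layer bound `‖K_r‖ ≤ C q̂^{1−δ} / r` (`δ > 0` may depend on `P, Q, Δ'`):
* `sum_Icc_inv_le_one_add_log`: `Σ_{R₁ < r ≤ R₂} 1/r ≤ 1 + log R₂`;
* `norm_band_le_of_layer_le`: `‖BAND(ρ₁,ρ₂)‖ ≤ B (1 + log ⌊q̂^{ρ₂}⌋)` from `‖K_r‖ ≤ B/r` on the band;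
* `one_add_mul_log_mul_rpow_neg_le`: `(1 + a log x) x^{−δ} ≤ K (log x)⁻³` for `x ≥ e` (`a ≥ 0`, `δ > 0`);
* `log_layerCount_rhoWeil_le`: `log ⌊q̂^{ρ_W(Δ')}⌋ ≤ 8 log q̂` on `(1, 3/2]`, `q ≥ 64`;
* **`subBand_rhoP_rhoWeil_of_layer_bound`**: a per-layer power saving on a window `(1, Δ₀]` gives `SubBand rhoP rhoWeil`;
* **`subFar_rhoP_of_layer_bound`**: … hence `SubFar rhoP` (the registered signature of `stub_farP`), by famedge-1's glue.
What it does NOT do: bound any layer (the per-layer bound in the band is the print/pencil content — Pascadi Thm 7.1 after the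
balanced regrouping, census CENSUS-leafhand2-g0-stub_farP-band{,-v2}.md on the crux item); K_A NOT proved; nothing about
Landau–Siegel zeros.
-/

noncomputable section

open Finset Polynomial
open Literature.NumberTheory.LFunctions

namespace Summit.Parity.GeneralizedHardyLittlewood.Theorems.MomentsBeyondDiagonal.Layers

open Summit.Parity.GeneralizedHardyLittlewood.Theorems.PrimeLevelFamEdgeIdeaDeltas.PeterssonLayers
open Summit.Parity.GeneralizedHardyLittlewood.Theorems.MomentsBeyondDiagonal.FarLayers (subFar_rhoP_of_band)
open Summit.Parity.GeneralizedHardyLittlewood.Theorems.MomentsBeyondDiagonal.TwoOrderAFE (exp_one_le_qhat)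

/-! ## §1. The harmonic block sum and the band from a per-layer bound -/

/-- `Σ_{R₁ < r ≤ R₂} 1/r ≤ 1 + log R₂` (Mathlib's `harmonic_le_one_add_log`; the empty cases are trivial). [folklore] -/
theorem sum_Icc_inv_le_one_add_log (R₁ R₂ : ℕ) :
    ∑ r ∈ Icc (R₁ + 1) R₂, ((r : ℝ))⁻¹ ≤ 1 + Real.log R₂ := by
  rcases Nat.eq_zero_or_pos R₂ with rfl | hR₂
  · simp
  have hsub : Icc (R₁ + 1) R₂ ⊆ Icc 1 R₂ := by
    intro r hr
    simp only [mem_Icc] at hr ⊢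
    omega
  have hfull : ∑ r ∈ Icc 1 R₂, ((r : ℝ))⁻¹ ≤ 1 + Real.log R₂ := by
    have h := harmonic_le_one_add_log R₂
    rw [harmonic_eq_sum_Icc] at h
    push_cast at h
    exact h
  exact (sum_le_sum_of_subset_of_nonneg hsub fun r _ _ ↦ by positivity).trans hfull

/-- **The band from a per-layer bound**: if `‖K_r‖ ≤ B / r` for every layer of `BAND(ρ₁, ρ₂)` (`B ≥ 0`), then
`‖BAND(ρ₁, ρ₂)‖ ≤ B · (1 + log ⌊q̂^{ρ₂(Δ')}⌋)`. [folklore] -/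
theorem norm_band_le_of_layer_le (q : ℕ) [NeZero q] (ρ₁ ρ₂ : ℝ → ℝ) (P Q : ℝ[X]) (Δ' : ℝ) {B : ℝ} (hB : 0 ≤ B)
    (h : ∀ r ∈ Icc (layerCount q ρ₁ Δ' + 1) (layerCount q ρ₂ Δ'), ‖layer q P Q Δ' r‖ ≤ B * ((r : ℝ))⁻¹) :
    ‖band q ρ₁ ρ₂ P Q Δ'‖ ≤ B * (1 + Real.log (layerCount q ρ₂ Δ')) := by
  unfold band
  calc ‖∑ r ∈ Icc (layerCount q ρ₁ Δ' + 1) (layerCount q ρ₂ Δ'), layer q P Q Δ' r‖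
      ≤ ∑ r ∈ Icc (layerCount q ρ₁ Δ' + 1) (layerCount q ρ₂ Δ'), ‖layer q P Q Δ' r‖ := norm_sum_le _ _
    _ ≤ ∑ r ∈ Icc (layerCount q ρ₁ Δ' + 1) (layerCount q ρ₂ Δ'), B * ((r : ℝ))⁻¹ := sum_le_sum h
    _ = B * ∑ r ∈ Icc (layerCount q ρ₁ Δ' + 1) (layerCount q ρ₂ Δ'), ((r : ℝ))⁻¹ := by rw [mul_sum]
    _ ≤ B * (1 + Real.log (layerCount q ρ₂ Δ')) :=
        mul_le_mul_of_nonneg_left (sum_Icc_inv_le_one_add_log _ _) hB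

/-! ## §2. Polylog against a power saving -/

/-- `(1 + a log x) · x^{−δ} ≤ K · (log x)⁻³` for `x ≥ e` (`a ≥ 0`, `δ > 0`; `K = (1 + a) ε⁻⁴`, `ε = δ/4`, from
`log x ≤ x^ε/ε` and `1 ≤ log x`). [folklore] -/
theorem one_add_mul_log_mul_rpow_neg_le {a δ : ℝ} (ha : 0 ≤ a) (hδ : 0 < δ) :
    ∃ K : ℝ, 0 ≤ K ∧ ∀ x : ℝ, Real.exp 1 ≤ x →
      (1 + a * Real.log x) * x ^ (-δ) ≤ K * (Real.log x)⁻¹ ^ 3 := by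
  set ε : ℝ := δ / 4 with hεdef
  have hε : 0 < ε := by rw [hεdef]; positivity
  refine ⟨(1 + a) * ε⁻¹ ^ 4, by positivity, fun x hx ↦ ?_⟩
  have hx1 : 1 ≤ x := le_trans (by have := Real.add_one_le_exp (1 : ℝ); linarith) hx
  have hx0 : 0 < x := by linarith
  have hlog1 : 1 ≤ Real.log x := by rwa [Real.le_log_iff_exp_le hx0]
  have hlog0 : 0 < Real.log x := by linarith
  -- `1 + a log x ≤ (1 + a) log x`
  have h1 : 1 + a * Real.log x ≤ (1 + a) * Real.log x := by nlinarith
  -- `(log x)^4 ≤ ε⁻⁴ x^δ`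
  have h2 : Real.log x ^ 4 ≤ ε⁻¹ ^ 4 * x ^ δ := by
    have hl : Real.log x ≤ x ^ ε / ε := Real.log_le_rpow_div hx0.le hε
    have hexp : ε * ((4 : ℕ) : ℝ) = δ := by rw [hεdef]; push_cast; ring
    calc Real.log x ^ 4 ≤ (x ^ ε / ε) ^ 4 := pow_le_pow_left₀ hlog0.le hl _
      _ = ε⁻¹ ^ 4 * (x ^ ε) ^ 4 := by rw [div_eq_mul_inv, mul_pow]; ring
      _ = ε⁻¹ ^ 4 * x ^ δ := by
          rw [← Real.rpow_natCast (x ^ ε) 4, ← Real.rpow_mul hx0.le, hexp]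
  have hxδ : 0 < x ^ δ := Real.rpow_pos_of_pos hx0 _
  have hneg : x ^ (-δ) = (x ^ δ)⁻¹ := Real.rpow_neg hx0.le _
  have hKeq : (1 + a) * ε⁻¹ ^ 4 * (Real.log x)⁻¹ ^ 3 = ((1 + a) * ε⁻¹ ^ 4) / Real.log x ^ 3 := by
    simp only [inv_pow, div_eq_mul_inv]
  rw [hKeq, le_div_iff₀ (pow_pos hlog0 3), hneg]
  rw [show (1 + a * Real.log x) * (x ^ δ)⁻¹ * Real.log x ^ 3 =
      ((1 + a * Real.log x) * Real.log x ^ 3) / x ^ δ by ring, div_le_iff₀ hxδ]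
  calc (1 + a * Real.log x) * Real.log x ^ 3 ≤ (1 + a) * Real.log x * Real.log x ^ 3 :=
        mul_le_mul_of_nonneg_right h1 (pow_nonneg hlog0.le 3)
    _ = (1 + a) * Real.log x ^ 4 := by ring
    _ ≤ (1 + a) * (ε⁻¹ ^ 4 * x ^ δ) := mul_le_mul_of_nonneg_left h2 (by positivity)
    _ = (1 + a) * ε⁻¹ ^ 4 * x ^ δ := by ring

/-- On the window `(1, 3/2]` and for `q ≥ 64`: `log ⌊q̂^{ρ_W(Δ')}⌋ ≤ 8 log q̂` (`ρ_W ≤ 8` there, `q̂ > 1`; the value `log 0 = 0`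
covers an empty band). [folklore] -/
theorem log_layerCount_rhoWeil_le {q : ℕ} [NeZero q] (hq : 64 ≤ q) {Δ' : ℝ} (h₁ : 1 < Δ') (h₂ : Δ' ≤ 3 / 2) :
    Real.log (layerCount q rhoWeil Δ' : ℝ) ≤ 8 * Real.log (KMV2000.qhat q) := by
  have hqh1 : 1 < KMV2000.qhat q := one_lt_qhat hq
  have hqh0 : 0 < KMV2000.qhat q := zero_lt_one.trans hqh1
  have hpow : 0 < KMV2000.qhat q ^ rhoWeil Δ' := Real.rpow_pos_of_pos hqh0 _
  rcases Nat.eq_zero_or_pos (layerCount q rhoWeil Δ') with h0 | hpos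
  · rw [h0]
    simp only [Nat.cast_zero, Real.log_zero]
    exact mul_nonneg (by norm_num) (Real.log_nonneg hqh1.le)
  have hfloor : ((layerCount q rhoWeil Δ' : ℕ) : ℝ) ≤ KMV2000.qhat q ^ rhoWeil Δ' := by
    unfold layerCount
    exact Nat.floor_le hpow.le
  have hcast : (0 : ℝ) < ((layerCount q rhoWeil Δ' : ℕ) : ℝ) := by exact_mod_cast hpos
  calc Real.log (layerCount q rhoWeil Δ' : ℝ) ≤ Real.log (KMV2000.qhat q ^ rhoWeil Δ') :=
        Real.log_le_log hcast hfloor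
    _ = rhoWeil Δ' * Real.log (KMV2000.qhat q) := Real.log_rpow hqh0 _
    _ ≤ 8 * Real.log (KMV2000.qhat q) :=
        mul_le_mul_of_nonneg_right (rhoWeil_le_eight Δ' h₁ h₂) (Real.log_nonneg hqh1.le)

/-! ## §3. The print band, and `stub_farP`'s signature, from a per-layer power saving -/

/-- **The PRINT BAND from a PER-LAYER POWER SAVING.** If on some window `(1, Δ₀]` (`Δ₀ > 1`), for every admissible `P`,
even-or-odd `Q` and `Δ'` in the window there are `C`, `δ > 0`, `q₀` with
`‖K_r‖ ≤ C · q̂^{1−δ} / r` for all primes `q ≥ q₀` (with `q̂^{Δ'} ∉ ℕ`) and all layers `⌊q̂^{ρ_P}⌋ < r ≤ ⌊q̂^{ρ_W}⌋`,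
then `SubBand rhoP rhoWeil` (functional `t = 0`; window shrunk to `(1, min Δ₀ 3/2]`, threshold raised to `≥ 324`).
[folklore] -/
theorem subBand_rhoP_rhoWeil_of_layer_bound {Δ₀ : ℝ} (hΔ₀ : 1 < Δ₀)
    (h : ∀ P Q : ℝ[X], KMV2000.Admissible P → KMV2000.IsEvenOrOdd Q → ∀ Δ' : ℝ, 1 < Δ' → Δ' ≤ Δ₀ →
      ∃ C δ : ℝ, 0 < δ ∧ ∃ q₀ : ℕ, ∀ (q : ℕ) [NeZero q], q.Prime → q₀ ≤ q →
        (∀ n : ℕ, (n : ℝ) ≠ KMV2000.qhat q ^ Δ') →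
        ∀ r ∈ Icc (layerCount q rhoP Δ' + 1) (layerCount q rhoWeil Δ'),
          ‖layer q P Q Δ' r‖ ≤ C * KMV2000.qhat q ^ (1 - δ) * ((r : ℝ))⁻¹) :
    SubBand rhoP rhoWeil := by
  refine subBand_rhoP_rhoWeil_of_norm_le_window (Δ₀ := min Δ₀ (3 / 2)) (lt_min hΔ₀ (by norm_num)) ?_
  intro P Q hP hQ Δ' h1 h2
  have hΔ₀' : Δ' ≤ Δ₀ := h2.trans (min_le_left _ _)
  have h32 : Δ' ≤ 3 / 2 := h2.trans (min_le_right _ _)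
  obtain ⟨C, δ, hδ, q₀, hC⟩ := h P Q hP hQ Δ' h1 hΔ₀'
  obtain ⟨K, hK0, hK⟩ := one_add_mul_log_mul_rpow_neg_le (a := 8) (by norm_num) hδ
  refine ⟨max C 0 * K, max q₀ 324, fun q _ hq hq₀ hM ↦ ?_⟩
  have hq₀' : q₀ ≤ q := le_trans (le_max_left _ _) hq₀
  have h324 : 324 ≤ q := le_trans (le_max_right _ _) hq₀
  have h64 : 64 ≤ q := le_trans (by norm_num) h324
  have hqh1 : 1 < KMV2000.qhat q := one_lt_qhat h64
  have hqh0 : 0 < KMV2000.qhat q := zero_lt_one.trans hqh1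
  have hqe : Real.exp 1 ≤ KMV2000.qhat q := exp_one_le_qhat h324
  have hC0 : 0 ≤ max C 0 := le_max_right _ _
  -- per-layer bound with the non-negative constant `max C 0`
  have hB : 0 ≤ max C 0 * KMV2000.qhat q ^ (1 - δ) := mul_nonneg hC0 (Real.rpow_nonneg hqh0.le _)
  have hlayer : ∀ r ∈ Icc (layerCount q rhoP Δ' + 1) (layerCount q rhoWeil Δ'),
      ‖layer q P Q Δ' r‖ ≤ max C 0 * KMV2000.qhat q ^ (1 - δ) * ((r : ℝ))⁻¹ := by
    intro r hr
    refine (hC q hq hq₀' hM r hr).trans ?_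
    exact mul_le_mul_of_nonneg_right (mul_le_mul_of_nonneg_right (le_max_left _ _) (Real.rpow_nonneg hqh0.le _))
      (by positivity)
  have hband := norm_band_le_of_layer_le q rhoP rhoWeil P Q Δ' hB hlayer
  -- `1 + log ⌊q̂^{ρ_W}⌋ ≤ 1 + 8 log q̂`
  have hlogR : 1 + Real.log (layerCount q rhoWeil Δ' : ℝ) ≤ 1 + 8 * Real.log (KMV2000.qhat q) := by
    linarith [log_layerCount_rhoWeil_le h64 h1 h32]
  have hlog0 : 0 ≤ 1 + 8 * Real.log (KMV2000.qhat q) := by linarith [Real.log_nonneg hqh1.le]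
  -- `q̂^{1-δ} = q̂ · q̂^{-δ}`
  have hsplit : KMV2000.qhat q ^ (1 - δ) = KMV2000.qhat q * KMV2000.qhat q ^ (-δ) := by
    rw [sub_eq_add_neg, Real.rpow_add hqh0, Real.rpow_one]
  have hpoly := hK (KMV2000.qhat q) hqe
  calc ‖band q rhoP rhoWeil P Q Δ'‖
      ≤ max C 0 * KMV2000.qhat q ^ (1 - δ) * (1 + Real.log (layerCount q rhoWeil Δ' : ℝ)) := hband
    _ ≤ max C 0 * KMV2000.qhat q ^ (1 - δ) * (1 + 8 * Real.log (KMV2000.qhat q)) :=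
        mul_le_mul_of_nonneg_left hlogR hB
    _ = max C 0 * KMV2000.qhat q * ((1 + 8 * Real.log (KMV2000.qhat q)) * KMV2000.qhat q ^ (-δ)) := by
        rw [hsplit]; ring
    _ ≤ max C 0 * KMV2000.qhat q * (K * (Real.log (KMV2000.qhat q))⁻¹ ^ 3) :=
        mul_le_mul_of_nonneg_left hpoly (mul_nonneg hC0 hqh0.le)
    _ = max C 0 * K * KMV2000.qhat q * (Real.log (KMV2000.qhat q))⁻¹ ^ 3 := by ring

/-- **`stub_farP`'s signature `SubFar rhoP` from a PER-LAYER POWER SAVING in the print band** (famedge-1's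
`FarLayers.subFar_rhoP_of_band` ∘ `subBand_rhoP_rhoWeil_of_layer_bound`): the remaining content of `stub_farP` is exactly a
bound `‖K_r‖ ≤ C q̂^{1−δ}/r` for the layers `q̂^{ρ_P} < r ≤ q̂^{ρ_W}` on some window `(1, Δ₀]`. [folklore] -/
theorem subFar_rhoP_of_layer_bound {Δ₀ : ℝ} (hΔ₀ : 1 < Δ₀)
    (h : ∀ P Q : ℝ[X], KMV2000.Admissible P → KMV2000.IsEvenOrOdd Q → ∀ Δ' : ℝ, 1 < Δ' → Δ' ≤ Δ₀ →
      ∃ C δ : ℝ, 0 < δ ∧ ∃ q₀ : ℕ, ∀ (q : ℕ) [NeZero q], q.Prime → q₀ ≤ q →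
        (∀ n : ℕ, (n : ℝ) ≠ KMV2000.qhat q ^ Δ') →
        ∀ r ∈ Icc (layerCount q rhoP Δ' + 1) (layerCount q rhoWeil Δ'),
          ‖layer q P Q Δ' r‖ ≤ C * KMV2000.qhat q ^ (1 - δ) * ((r : ℝ))⁻¹) :
    SubFar rhoP :=
  subFar_rhoP_of_band (subBand_rhoP_rhoWeil_of_layer_bound hΔ₀ h)

end Summit.Parity.GeneralizedHardyLittlewood.Theorems.MomentsBeyondDiagonal.Layers

end
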